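import Literature.AlgebraicGeometry.Modules.FittingIdealSheafOfModule
import Literature.RingTheory.FittingIdeal.FinitePresentation
import Mathlib.AlgebraicGeometry.Morphisms.FinitePresentation
import Mathlib.AlgebraicGeometry.IdealSheaf.Subscheme
import Mathlib.RingTheory.RingHom.FinitePresentation
import HarnessLib

/-!
# The Fitting strata `Z_r ↪ S`, `S ∖ Z_r ↪ S` are of finite presentation for a finitely presented module
# (Stacks 0C3E, 05P8)

Topic `Literature/AlgebraicGeometry/Modules`, namespace `Literature.AlgebraicGeometry.Modules`.  THEOREMS ONLY (no
definition, no instance, no notation, no named fact, no `sorry`).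

The Stacks Project, Tag 0C3E (Divisors, Lemma 31.9.2): "Let `S` be a scheme. Let `F` be a finitely presented
`𝒪_S`-module. Then `Fit_r(F)` is a quasi-coherent ideal of finite type."  and Tag 05P8 (Lemma 31.9.6), last clause and
its proof: "If `F` is of finite presentation, then `Z_r → S`, `S ∖ Z_r → S`, and `Z_{r-1} ∖ Z_r → S` are of finite
presentation. […] Assume `F` is of finite presentation. Then each of the morphisms `Z_r → S` is of finite presentation as
`Fit_r(F)` is of finite type (Lemma 31.9.2 and Morphisms, Lemma 29.22.7). This implies that `Z_{r-1} ∖ Z_r` is a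
retrocompact open in `Z_r` (Properties, Lemma 28.25.1) and hence the morphism `Z_{r-1} ∖ Z_r → Z_r` is of finite
presentation as well."

For Mathlib's `Scheme.IdealSheafData` (`I.subscheme`, `I.subschemeι`, `I.support`) and the tree's Fitting ideal sheaves
(★ `Modules/FittingIdealSheafOfModule`, affine-localizing modules of affine-finite type), with finite presentation of the
module stated affine-locally (`∀ affine V, Module.FinitePresentation Γ(V, 𝒪) Γ(V, M)`):

* §1 generic ideal sheaves with finitely generated ideals of sections (`hI : ∀ U, (I.ideal U).FG`):
  **`locallyOfFinitePresentation_subscheme_of_fg`** (`V(I) ↪ X` is locally of finite presentation — Morphisms, Lemma 29.22.7 as used in the proof of 05P8),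
  `compl_support_inter_eq_biUnion_basicOpen` (on an affine `V`, `(X ∖ Supp 𝒪/I) ∩ V = ⋃_{f ∈ gens} D(f)`),
  **`isCompact_compl_support_inter`** and **`quasiCompact_complSupport_inclusion`** (`X ∖ Supp(𝒪/I)` is retrocompact).
* §2 **`fg_ideal_fittingIdealSheaf`** (0C3E) and the corollaries for `Z_r = V(Fit_r(M))`:
  `locallyOfFinitePresentation_fittingSubscheme`, `quasiCompact_fittingComplSupport_inclusion`.
* §3 the locally closed stratum `Z_{r-1} ∖ Z_r` as the open `ι⁻¹(S ∖ Z_r)` of `Z_{r-1}`: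
  **`locallyOfFinitePresentation_stratum`**, **`quasiCompact_stratum`** (05P8, last clause).

Cell `hodgecm-mathlib` (D-0151) count-neutral Mathlib-side capital (F-DAG F-5 (5b): the flattening strata are of finite
presentation); nothing here is about HC — HC_CM is proved only modulo the 7 printed citations until rung 0 closes.

## References

* The Stacks Project, Tags 0C3E, 05P8 (Divisors §31.9; the proof of 05P8 invokes Morphisms, Lemma 29.22.7 and
  Properties, Lemma 28.25.1). [StacksProject]
-/

noncomputable section

universe u

open CategoryTheory AlgebraicGeometry TopologicalSpace Opposite

namespace Literature.AlgebraicGeometry.Modules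

open Literature.RingTheory.FittingIdeal

/-! ## §1 Ideal sheaves with finitely generated ideals of sections -/

section FG

variable {X : Scheme.{u}} (I : X.IdealSheafData) (hI : ∀ U : X.affineOpens, (I.ideal U).FG)

include hI in
/-- **A closed immersion cut out by an ideal sheaf of finite type is locally of finite presentation**: over an affine
`U`, `Γ(U, 𝒪_X) → Γ(U, 𝒪_X)/I(U)` is surjective with finitely generated kernel (Mathlib `ker_subschemeι_app`,
`RingHom.FinitePresentation.of_surjective`). [cite: StacksProject, Tag 05P8] -/
theorem locallyOfFinitePresentation_subscheme_of_fg : LocallyOfFinitePresentation I.subschemeι := by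
  rw [HasRingHomProperty.iff_exists_appLE (P := @LocallyOfFinitePresentation)
    (RingHom.finitePresentation_stableUnderComposition.stableUnderCompositionWithLocalizationAway
      RingHom.finitePresentation_holdsForLocalizationAway).1]
  intro x
  obtain ⟨_, ⟨U, hU, rfl⟩, hxU, -⟩ :=
    X.isBasis_affineOpens.exists_subset_of_mem_open (Set.mem_univ (I.subschemeι.base x)) isOpen_univ
  refine ⟨⟨U, hU⟩, ⟨I.subschemeι ⁻¹ᵁ U, hU.preimage _⟩, hxU, le_rfl, ?_⟩
  rw [← Scheme.Hom.app_eq_appLE]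
  exact RingHom.FinitePresentation.of_surjective _ (I.subschemeι_app_surjective ⟨U, hU⟩)
    (by rw [I.ker_subschemeι_app ⟨U, hU⟩]; exact hI ⟨U, hU⟩)

/-- On an affine open `V`, the complement of the support of `𝒪_X/I` is the union of the basic opens of a generating set
of `I(V)`. [cite: StacksProject, Tag 05P8] -/
theorem compl_support_inter_eq_biUnion_basicOpen (V : X.affineOpens) {s : Set Γ(X, V)}
    (hs : Ideal.span s = I.ideal V) :
    ((I.support : Set X)ᶜ) ∩ (V : Set X) = ⋃ f ∈ s, (X.basicOpen f : Set X) := by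
  ext x
  simp only [Set.mem_inter_iff, Set.mem_compl_iff, Set.mem_iUnion, exists_prop, SetLike.mem_coe]
  constructor
  · rintro ⟨hx, hxV⟩
    rw [Scheme.IdealSheafData.mem_support_iff_of_mem (U := V) hxV, ← hs, Scheme.zeroLocus_span,
      Scheme.mem_zeroLocus_iff] at hx
    simpa only [not_forall, not_not, exists_prop] using hx
  · rintro ⟨f, hf, hxf⟩
    have hxV : x ∈ (V : X.Opens) := X.basicOpen_le f hxf
    refine ⟨fun hx => ?_, hxV⟩
    rw [Scheme.IdealSheafData.mem_support_iff_of_mem (U := V) hxV, ← hs, Scheme.zeroLocus_span,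
      Scheme.mem_zeroLocus_iff] at hx
    exact hx f hf hxf

include hI in
/-- **`X ∖ Supp(𝒪_X/I)` meets every affine open in a quasi-compact set** when the ideals `I(V)` are finitely generated
(a finite union of basic opens). [cite: StacksProject, Tag 05P8] -/
theorem isCompact_compl_support_inter (V : X.affineOpens) : IsCompact (((I.support : Set X)ᶜ) ∩ (V : Set X)) := by
  obtain ⟨s, hs⟩ := hI V
  rw [compl_support_inter_eq_biUnion_basicOpen I V hs]
  exact s.finite_toSet.isCompact_biUnion fun f _ => isCompact_basicOpen X V.2.isCompact f

include hI in
/-- **`X ∖ Supp(𝒪_X/I)` is a retrocompact open**: its inclusion is quasi-compact (Stacks 05P8 proof: «`Z_{r-1} ∖ Z_r`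
is a retrocompact open in `Z_r`»). [cite: StacksProject, Tag 05P8] -/
theorem quasiCompact_complSupport_inclusion : QuasiCompact (Scheme.Opens.ι (I.support.compl : X.Opens)) := by
  rw [quasiCompact_iff_forall_isAffineOpen]
  intro V hV
  rw [(Scheme.Opens.ι (I.support.compl : X.Opens)).isOpenEmbedding.isCompact_iff]
  have h : ⇑(Scheme.Opens.ι (I.support.compl : X.Opens)).base ''
      ((Scheme.Opens.ι (I.support.compl : X.Opens) ⁻¹ᵁ V : Opens _) : Set _) =
      ((I.support : Set X)ᶜ) ∩ (V : Set X) := by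
    change ⇑(Scheme.Opens.ι (I.support.compl : X.Opens)).base ''
      (⇑(Scheme.Opens.ι (I.support.compl : X.Opens)).base ⁻¹' (V : Set X)) = _
    rw [Set.image_preimage_eq_inter_range, Set.inter_comm]
    congr 1
    exact (Scheme.Opens.range_ι _).trans (Closeds.coe_compl _)
  rw [h]
  exact isCompact_compl_support_inter I hI ⟨V, hV⟩

end FG

/-! ## §2 The Fitting ideal sheaves of a finitely presented module are of finite type (0C3E) -/

section Fitting

variable {X : Scheme.{u}} {M : X.Modules} (hM : IsAffineLocalizing M) (hfin : IsAffineFiniteType M)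
  (hfp : ∀ ⦃V : X.Opens⦄, IsAffineOpen V → Module.FinitePresentation Γ(X, V) Γ(M, V))

include hfp in
/-- **Stacks 0C3E**: for `M` finitely presented on affine opens, the ideals `Fit_r(M)(V)` are finitely generated
(★ `Module.fittingIdeal_fg`: the `(n-r)`-minors of a finite presentation matrix). [cite: StacksProject, Tag 0C3E] -/
theorem fg_ideal_fittingIdealSheaf (r : ℕ) (V : X.affineOpens) : ((fittingIdealSheaf M hM hfin r).ideal V).FG := by
  haveI := hfp V.2
  exact Module.fittingIdeal_fg (R := Γ(X, V)) (M := Γ(M, V)) r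

include hfp in
/-- **`Z_r = V(Fit_r(M)) ↪ X` is locally of finite presentation** (0C3E + Morphisms, Lemma 29.22.7). [cite: StacksProject, Tag 05P8]
[cite: StacksProject, Tag 0C3E] -/
theorem locallyOfFinitePresentation_fittingSubscheme (r : ℕ) :
    LocallyOfFinitePresentation (fittingIdealSheaf M hM hfin r).subschemeι :=
  locallyOfFinitePresentation_subscheme_of_fg _ (fg_ideal_fittingIdealSheaf hM hfin hfp r)

include hfp in
/-- **`X ∖ Z_r(M)` is retrocompact**: the inclusion of the open complement of `Supp(𝒪_X/Fit_r(M))` is quasi-compact.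
[cite: StacksProject, Tag 05P8] -/
theorem quasiCompact_fittingComplSupport_inclusion (r : ℕ) :
    QuasiCompact (Scheme.Opens.ι ((fittingIdealSheaf M hM hfin r).support.compl : X.Opens)) :=
  quasiCompact_complSupport_inclusion _ (fg_ideal_fittingIdealSheaf hM hfin hfp r)

/-! ## §3 The locally closed stratum `Z_{r-1} ∖ Z_r` is of finite presentation over `X` -/

/-- The open `ι_Z⁻¹(X ∖ Z')` of a closed subscheme `ι_Z : Z ↪ X`, for `X ∖ Z'` retrocompact, has quasi-compact inclusion
into `Z` (base change of a quasi-compact open immersion). [cite: StacksProject, Tag 05P8] -/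
theorem quasiCompact_preimage_inclusion {Z : Scheme.{u}} (g : Z ⟶ X) (U : X.Opens) [QuasiCompact U.ι] :
    QuasiCompact (g ⁻¹ᵁ U).ι := by
  exact MorphismProperty.of_isPullback (P := @QuasiCompact) (isPullback_morphismRestrict g U) inferInstance

include hfp in
/-- **Stacks 05P8, last clause**: the stratum `Z_k ∖ Z_r = ι_{Z_k}⁻¹(X ∖ Z_r) ↪ Z_k ↪ X` (`k ≤ r`; the locally free
locus of rank `r` is `k = r - 1`) is LOCALLY OF FINITE PRESENTATION over `X`. [cite: StacksProject, Tag 05P8] -/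
theorem locallyOfFinitePresentation_stratum (k r : ℕ) :
    LocallyOfFinitePresentation
      (((fittingIdealSheaf M hM hfin k).subschemeι ⁻¹ᵁ
          ((fittingIdealSheaf M hM hfin r).support.compl : X.Opens)).ι ≫
        (fittingIdealSheaf M hM hfin k).subschemeι) := by
  haveI := locallyOfFinitePresentation_fittingSubscheme hM hfin hfp k
  infer_instance

include hfp in
/-- **Stacks 05P8, last clause**: the stratum `Z_k ∖ Z_r ↪ X` is QUASI-COMPACT (hence, with the previous theorem and
separatedness of immersions, of finite presentation). [cite: StacksProject, Tag 05P8] -/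
theorem quasiCompact_stratum (k r : ℕ) :
    QuasiCompact
      (((fittingIdealSheaf M hM hfin k).subschemeι ⁻¹ᵁ
          ((fittingIdealSheaf M hM hfin r).support.compl : X.Opens)).ι ≫
        (fittingIdealSheaf M hM hfin k).subschemeι) := by
  haveI := quasiCompact_fittingComplSupport_inclusion hM hfin hfp r
  haveI := quasiCompact_preimage_inclusion (fittingIdealSheaf M hM hfin k).subschemeι
    ((fittingIdealSheaf M hM hfin r).support.compl : X.Opens)
  infer_instance

/-- The stratum `Z_k ∖ Z_r ↪ X` is separated (an immersion); with the two previous theorems it is a morphism OF FINITE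
PRESENTATION (locally of finite presentation, quasi-compact, quasi-separated). [cite: StacksProject, Tag 05P8] -/
theorem isSeparated_stratum (k r : ℕ) :
    IsSeparated
      (((fittingIdealSheaf M hM hfin k).subschemeι ⁻¹ᵁ
          ((fittingIdealSheaf M hM hfin r).support.compl : X.Opens)).ι ≫
        (fittingIdealSheaf M hM hfin k).subschemeι) := by
  infer_instance

end Fitting

end Literature.AlgebraicGeometry.Modules

end
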